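import Mathlib

/-!
# Sup-norm Sturm principle on a window (stub `stub_supNormOfWindow`)

Stub `stub_supNormOfWindow` (S15) for the crux `HilbertIntegralOverconvergentIsCongruence`
(line Sketch-ideate-r1-k1).  Abstract setting: coefficient functionals `c x` (`x : X`) on a
`𝕂`-vector space `V`, a finite spanning family `b j` (`j : δ`) whose coefficients
`c x (b j) = A j x` are `R`-integral, a ring homomorphism `ψ : 𝕂 → ℚ̄_p` with `‖ψ r‖ ≤ 1` on `R`
and `‖ψ D‖ = 1` off the ideal `𝔪`, and the output of the adjugate trick on a finite window `W`:
for every `m` an element `D ∉ 𝔪` and `k : X → R` with `D · A j m = ∑_{x ∈ W} k x · A j x` for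
all `j`.  Then `p`-adic smallness of the window coefficients of any `G ∈ V` propagates to all
coefficients.

## Proof

Write `G = ∑ g_j • b_j`.  Then `c x G = ∑_j g_j · A j x`, so multiplying the adjugate identity by
`g_j` and summing over `j` gives `D · c m G = ∑_{x ∈ W} k x · c x G` in `𝕂`.  Apply `ψ` and the
strong triangle inequality in `ℚ̄_p`: `‖ψ D‖ = 1`, `‖ψ (k x)‖ ≤ 1`, `‖ψ (c x G)‖ ≤ ε` on `W`.
-/

set_option linter.dupNamespace false

noncomputable section

namespace Summit.Langlands.Langlands.Theorems.HilbertIntegralOverconvergentIsCongruence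

/-- **Ultrametric step.** If `D · t = ∑_{x ∈ W} k x · u x` in `𝕂` with `‖ψ D‖ = 1`,
`‖ψ (k x)‖ ≤ 1` and `‖ψ (u x)‖ ≤ ε` for `x ∈ W`, then `‖ψ t‖ ≤ ε` (strong triangle inequality in
`ℚ̄_p`). -/
private theorem supWin_norm_le_of_combination {𝕂 X : Type*} [Field 𝕂] (p : ℕ) [Fact p.Prime]
    (ψ : 𝕂 →+* PadicAlgCl p) (W : Finset X) {D : 𝕂} (hD : ‖ψ D‖ = 1) (k u : X → 𝕂)
    (hk : ∀ x ∈ W, ‖ψ (k x)‖ ≤ 1) {t : 𝕂} (ht : D * t = ∑ x ∈ W, k x * u x) {ε : ℝ}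
    (hε : 0 ≤ ε) (hu : ∀ x ∈ W, ‖ψ (u x)‖ ≤ ε) : ‖ψ t‖ ≤ ε := by
  have hψ := congrArg ψ ht
  rw [map_mul, map_sum] at hψ
  have hnorm : ‖ψ t‖ = ‖ψ D * ψ t‖ := by rw [norm_mul, hD, one_mul]
  rw [hnorm, hψ]
  refine IsUltrametricDist.norm_sum_le_of_forall_le_of_nonneg hε fun x hx ↦ ?_
  rw [map_mul, norm_mul]
  calc ‖ψ (k x)‖ * ‖ψ (u x)‖ ≤ 1 * ε :=
        mul_le_mul (hk x hx) (hu x hx) (norm_nonneg _) zero_le_one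
    _ = ε := one_mul ε

/-- **stub S15 — `stub_supNormOfWindow` (S; the ultrametric conclusion).**  `ψ : 𝕂 → ℚ̄_p` a ring hom with
`‖ψ r‖ ≤ 1` on `R` and `‖ψ D‖ = 1` for `D ∉ 𝔪`; `c_x` linear coefficient functionals on a `𝕂`-space `V`,
`b_j` a finite SPANNING family with `R`-integral coefficients `A j x = c_x(b_j)`, and the output of S14 on the
window `W`.  Then every `G ∈ V` with `‖ψ (c_x G)‖ ≤ ε` for `x ∈ W` has `‖ψ (c_x G)‖ ≤ ε` for all `x`
(`G = Σ g_j b_j`, `D c_m G = Σ_{x∈W} k_x c_x G`, strong triangle inequality). [folklore] -/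
theorem stub_supNormOfWindow {R 𝕂 V X δ : Type*} [CommRing R] [Field 𝕂] [Algebra R 𝕂] [AddCommGroup V]
    [Module 𝕂 V] [Fintype δ] (p : ℕ) [Fact p.Prime] (ψ : 𝕂 →+* PadicAlgCl p)
    (hψ : ∀ r : R, ‖ψ (algebraMap R 𝕂 r)‖ ≤ 1) (𝔪 : Ideal R)
    (h𝔪 : ∀ r : R, r ∉ 𝔪 → ‖ψ (algebraMap R 𝕂 r)‖ = 1)
    (c : X → V →ₗ[𝕂] 𝕂) (b : δ → V) (hb : ⊤ ≤ Submodule.span 𝕂 (Set.range b))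
    (A : δ → X → R) (hAb : ∀ j x, algebraMap R 𝕂 (A j x) = c x (b j)) (W : Finset X)
    (htrick : ∀ m : X, ∃ D : R, D ∉ 𝔪 ∧ ∃ k : X → R, (∀ x, x ∉ W → k x = 0) ∧
      ∀ j, D * A j m = ∑ x ∈ W, k x * A j x)
    (G : V) (ε : ℝ) (hε : 0 ≤ ε) (hG : ∀ x ∈ W, ‖ψ (c x G)‖ ≤ ε) : ∀ x, ‖ψ (c x G)‖ ≤ ε := by
  intro m
  obtain ⟨D, hD, k, -, hk⟩ := htrick m
  -- Step 1: `G` is a `𝕂`-combination of the spanning family `b`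
  have hGmem : G ∈ Submodule.span 𝕂 (Set.range b) := hb Submodule.mem_top
  obtain ⟨g, rfl⟩ := (Submodule.mem_span_range_iff_exists_fun 𝕂).mp hGmem
  -- Step 2: the coefficients of `G` in terms of the integral matrix `A`
  have hcG : ∀ x, c x (∑ j, g j • b j) = ∑ j, g j * algebraMap R 𝕂 (A j x) := by
    intro x
    rw [map_sum]
    simp only [map_smul, smul_eq_mul, hAb]
  -- Step 3: the identity `D · c m G = ∑_{x ∈ W} k x · c x G`
  have hid : algebraMap R 𝕂 D * c m (∑ j, g j • b j) =
      ∑ x ∈ W, algebraMap R 𝕂 (k x) * c x (∑ j, g j • b j) := by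
    simp only [hcG]
    calc algebraMap R 𝕂 D * ∑ j, g j * algebraMap R 𝕂 (A j m)
        = ∑ j, g j * algebraMap R 𝕂 (D * A j m) := by
          rw [Finset.mul_sum]
          refine Finset.sum_congr rfl fun j _ ↦ ?_
          rw [map_mul]
          ring
      _ = ∑ j, g j * ∑ x ∈ W, algebraMap R 𝕂 (k x) * algebraMap R 𝕂 (A j x) := by
          refine Finset.sum_congr rfl fun j _ ↦ ?_
          rw [hk j, map_sum]
          simp only [map_mul]
      _ = ∑ x ∈ W, algebraMap R 𝕂 (k x) * ∑ j, g j * algebraMap R 𝕂 (A j x) := by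
          simp only [Finset.mul_sum]
          rw [Finset.sum_comm]
          refine Finset.sum_congr rfl fun x _ ↦ Finset.sum_congr rfl fun j _ ↦ ?_
          ring
  -- Step 4: apply `ψ` and the strong triangle inequality
  exact supWin_norm_le_of_combination p ψ W (h𝔪 D hD) (fun x ↦ algebraMap R 𝕂 (k x))
    (fun x ↦ c x (∑ j, g j • b j)) (fun x _ ↦ hψ (k x)) hid hε hG

end Summit.Langlands.Langlands.Theorems.HilbertIntegralOverconvergentIsCongruence

end
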